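import Mathlib.Analysis.Matrix.Spectrum
import Mathlib.LinearAlgebra.Matrix.Rank
import Mathlib.Algebra.Order.Star.Real
import Literature.Computability.AlgebraicComplexity.Yab15BRank
import HarnessLib

/-!
# Yabe 2015, Corollary 2.3 from Corollary 2.2: splitting a symmetric Gram matrix into psd parts

Topic `Literature/Computability/AlgebraicComplexity`; companion of `Yab15BRank.lean` (A. Yabe,
*Bi-polynomial rank and determinantal complexity*, arXiv:1504.00151, §2.1, held text p0005).
**Corollary 2.3** ("`brank(p)` is at least the half of the optimum value of … Minimize
`rank(Q₊) + rank(Q₋)` subject to `p(x) = v(x)ᵀ(Q₊ − Q₋)v(x)`, `Q₊, Q₋ ∈ Psd_{s_k}`") follows from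
**Corollary 2.2** (the same with one symmetric `Q`) by the step the source leaves implicit: a real
symmetric `Q` is `Q₊ − Q₋` with `Q₊, Q₋` positive semidefinite and `rank Q₊ + rank Q₋ = rank Q`
(spectral theorem: `Q = U diag(λ) Uᵀ`, `Q_± = U diag(max(±λ, 0)) Uᵀ`;
`Yabe.exists_posSemidef_sub_rank_add`). Hence
`yabe2015_cor_2_3_of_cor_2_2 : yabe2015_cor_2_2 → yabe2015_cor_2_3`; with the discharge
`yabe2015_cor_2_2_holds` of `Yab15BRank.lean` this gives `yabe2015_cor_2_3_holds` (appended once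
that discharge has landed). No new definitions, no new facts.

## References

* [Yabe2015] A. Yabe, *Bi-polynomial rank and determinantal complexity*, arXiv:1504.00151 (2015),
  §2.1, Cors. 2.2–2.3 (held text p0005).
* [HornJohnson2013] R. A. Horn, C. R. Johnson, *Matrix Analysis*, 2nd ed., Thm. 4.1.5 (spectral
  theorem for Hermitian matrices).
-/

noncomputable section

open Matrix Finset

namespace Literature.Computability.AlgebraicComplexity

universe v

namespace Yabe

variable {n : Type v} [Fintype n] [DecidableEq n]

/-- **Positive and negative parts of a real symmetric matrix**: a real symmetric `Q` is a
difference `Q₊ − Q₋` of positive semidefinite matrices with `rank Q₊ + rank Q₋ = rank Q`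
(`Q = U diag(λ) Uᵀ` by the spectral theorem; `Q_± := U diag(max(±λ,0)) Uᵀ`; the ranks count the
positive, resp. negative, eigenvalues). This is the step from Yabe's Cor. 2.2 to Cor. 2.3 ("split
`Q` as `Q₊ − Q₋`"). [cite: HornJohnson2013, Thm. 4.1.5] -/
theorem exists_posSemidef_sub_rank_add {Q : Matrix n n ℝ} (hQ : Q.IsSymm) :
    ∃ Qp Qm : Matrix n n ℝ, Qp.PosSemidef ∧ Qm.PosSemidef ∧ Qp - Qm = Q ∧
      Qp.rank + Qm.rank = Q.rank := by
  classical
  have hH : Q.IsHermitian := Matrix.isHermitian_iff_isSymm.mpr hQ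
  set U : Matrix n n ℝ := (hH.eigenvectorUnitary : Matrix n n ℝ) with hU
  set lam : n → ℝ := hH.eigenvalues with hlam
  -- the spectral theorem over `ℝ`: `Q = U diag(λ) Uᵀ`
  have hspec : Q = U * diagonal lam * star U := by
    have h := hH.spectral_theorem
    rw [Unitary.conjStarAlgAut_apply, RCLike.ofReal_real_eq_id, Function.id_comp] at h
    exact h
  have hUU : U * star U = 1 := Unitary.coe_mul_star_self _
  have hUU' : star U * U = 1 := Unitary.coe_star_mul_self _
  have hdetU : IsUnit U.det := by
    refine IsUnit.of_mul_eq_one (star U).det ?_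
    rw [← det_mul, hUU, det_one]
  have hdetU' : IsUnit (star U).det := by
    refine IsUnit.of_mul_eq_one U.det ?_
    rw [← det_mul, hUU', det_one]
  -- the two parts
  set dp : n → ℝ := fun i => max (lam i) 0 with hdp
  set dm : n → ℝ := fun i => max (-lam i) 0 with hdm
  have hrankU : ∀ d : n → ℝ, (U * diagonal d * star U).rank = Fintype.card {i // d i ≠ 0} := by
    intro d
    rw [rank_mul_eq_left_of_isUnit_det (star U) _ hdetU', rank_mul_eq_right_of_isUnit_det U _ hdetU,
      rank_diagonal]
  have hpsdU : ∀ d : n → ℝ, (∀ i, 0 ≤ d i) → (U * diagonal d * star U).PosSemidef := by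
    intro d hd
    have hD : (diagonal d).PosSemidef := posSemidef_diagonal_iff.mpr hd
    simpa only [star_eq_conjTranspose] using hD.mul_mul_conjTranspose_same U
  refine ⟨U * diagonal dp * star U, U * diagonal dm * star U,
    hpsdU dp fun i => le_max_right _ _, hpsdU dm fun i => le_max_right _ _, ?_, ?_⟩
  · -- `Q₊ − Q₋ = U diag(max(λ,0) − max(−λ,0)) Uᵀ = U diag(λ) Uᵀ = Q`
    rw [hspec, ← Matrix.sub_mul, ← Matrix.mul_sub, diagonal_sub]
    congr 3
    funext i
    exact max_zero_sub_max_neg_zero_eq_self (lam i)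
  · -- ranks: `#{λ > 0} + #{λ < 0} = #{λ ≠ 0}`
    rw [hrankU, hrankU, hspec, hrankU, Fintype.card_subtype, Fintype.card_subtype,
      Fintype.card_subtype]
    have hp : (univ.filter fun i => dp i ≠ 0) = univ.filter fun i => 0 < lam i := by
      refine filter_congr fun i _ => ?_
      simp only [hdp, ne_eq, max_eq_right_iff, not_le]
    have hm : (univ.filter fun i => dm i ≠ 0) = univ.filter fun i => lam i < 0 := by
      refine filter_congr fun i _ => ?_
      simp only [hdm, ne_eq, max_eq_right_iff, not_le, neg_pos]
    rw [hp, hm, ← card_union_of_disjoint]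
    · congr 1
      ext i
      simp only [mem_union, mem_filter, mem_univ, true_and, ne_eq]
      constructor
      · rintro (h | h)
        · exact h.ne'
        · exact h.ne
      · intro h
        rcases lt_or_gt_of_ne h with h' | h'
        · exact Or.inr h'
        · exact Or.inl h'
    · rw [disjoint_filter]
      intro i _ h1 h2
      exact lt_asymm h1 h2

end Yabe

/-- **Yabe 2015, Corollary 2.3 from Corollary 2.2** (p0005): the psd-pair rank optimum is at most
the symmetric rank optimum (split the optimal symmetric `Q` as `Q₊ − Q₋`,
`Yabe.exists_posSemidef_sub_rank_add`), which Cor. 2.2 bounds by `2·brank(p)`. If no symmetric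
Gram matrix exists then no psd pair exists either and both `sInf` are the junk value `0`.
[cite: Yabe2015, Corollary 2.3] -/
theorem yabe2015_cor_2_3_of_cor_2_2 (h22 : yabe2015_cor_2_2.{v}) : yabe2015_cor_2_3.{v} := by
  intro σ _ _ k p hp
  refine le_trans ?_ (h22 σ k p hp)
  set S₂ : Set (Matrix (DegIdx σ k) (DegIdx σ k) ℝ) := {Q | Q.IsSymm ∧ gramPoly k Q = p} with hS₂
  set S₃ := {QQ : Matrix (DegIdx σ k) (DegIdx σ k) ℝ × Matrix (DegIdx σ k) (DegIdx σ k) ℝ |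
    QQ.1.PosSemidef ∧ QQ.2.PosSemidef ∧ gramPoly k (QQ.1 - QQ.2) = p} with hS₃
  by_cases hne : (Matrix.rank '' S₂).Nonempty
  · obtain ⟨Q, ⟨hQs, hQp⟩, hQr⟩ := Nat.sInf_mem hne
    rw [← hQr]
    obtain ⟨Qp, Qm, hQp', hQm', hsub, hrank⟩ := Yabe.exists_posSemidef_sub_rank_add hQs
    refine Nat.sInf_le ⟨(Qp, Qm), ⟨hQp', hQm', ?_⟩, hrank⟩
    · show gramPoly k (Qp - Qm) = p
      rw [hsub]
      exact hQp
  · rw [Set.not_nonempty_iff_eq_empty] at hne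
    have h3 : ((fun QQ : Matrix (DegIdx σ k) (DegIdx σ k) ℝ × Matrix (DegIdx σ k) (DegIdx σ k) ℝ =>
        QQ.1.rank + QQ.2.rank) '' S₃) = ∅ := by
      rw [Set.image_eq_empty]
      rw [Set.image_eq_empty] at hne
      rw [Set.eq_empty_iff_forall_notMem] at hne ⊢
      rintro ⟨Qp, Qm⟩ ⟨hQp', hQm', hQQ⟩
      refine hne (Qp - Qm) ⟨?_, hQQ⟩
      exact (Matrix.isHermitian_iff_isSymm.mp hQp'.1).sub (Matrix.isHermitian_iff_isSymm.mp hQm'.1)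
    rw [hne, h3]

end Literature.Computability.AlgebraicComplexity

end
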